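import Literature.Analysis.FluidPDE.ClassicalL2Stability
import HarnessLib

/-!
# The `L^θ` energy balance on a slab (Lemarié-Rieusset 2016, §11.5, proof of Prop. 11.7, (11.44)/(11.51))

Analysis/FluidPDE proof file (theorems only: no definition, no named fact, no `sorry`). First
brick of the `ℝ³` energy method "estimate `d/dt ‖u(t)‖_θ^θ`" of P. G. Lemarié-Rieusset,
*The Navier–Stokes Problem in the 21st Century* (2016), §11.5, proof of Prop. 11.7 (the pressure
criteria of Berselli–Galdi / Chae–Lee / Zhou / Struwe), eq. (11.44) (`θ = 4`) and eq. (11.51)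
(general `θ`): `d/dt ∫ |u|^θ dx = θ ∫ |u|^{θ-2} ∂ₜu · u dx`, here in integrated form on a closed
slab `[0, T] × ℝ³` for a jointly smooth, bounded field with `u, ∂ₜu ∈ L^∞_t L²_x` — exactly the
regularity of the classical patches of Tao's `L²`-Sobolev class on which the tree runs its
Grönwall arguments (`IsSmoothSpaceTimeOn.enstrophy_balance`, `IsSmoothSpaceTimeOn.l2_balance`,
whose proof pattern — pointwise time derivative, fundamental theorem of calculus on time lines,
Fubini — is copied verbatim with the density `θ‖w‖^{θ-2}⟪w, ∂ₜw⟫`).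

It is vendored by the literature seat of the cell `pub-nsfunc` ("search for candidate a priori
estimates; no regularity claim") as infrastructure towards the discharge of the named fact
`pressureGradientCriterion` (`GradientRegularityCriteria.lean`, Lemarié-Rieusset Prop. 11.7 second
item), whose printed proof is an `L⁴` / `L^θ` energy estimate (PDF pp. 362–366).

## References

* [LemarieRieusset2016] P. G. Lemarié-Rieusset, *The Navier–Stokes Problem in the 21st Century*,
  CRC Press 2016, §11.5, proof of Prop. 11.7, (11.44) and (11.51) (held text, PDF pp. 362, 365).
-/

noncomputable section

open MeasureTheory Set Function Filter Topology InnerProductSpace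
open scoped ENNReal NNReal ContDiff RealInnerProductSpace

namespace Literature.Analysis.FluidPDE

section Balance

/-- **The `L^θ` balance on a closed slab** (Lemarié-Rieusset 2016, proof of Prop. 11.7,
(11.44) for `θ = 4` and (11.51) for general `θ`: `d/dt ∫|u|^θ = θ ∫ |u|^{θ-2} ∂ₜu·u dx`). For `w`
jointly smooth on `[0, T] × ℝ³`, bounded (`‖w‖ ≤ B₀`), with `∫‖w(t)‖² ≤ C₀` and `∫‖∂ₜw(t)‖² ≤ C₁`
on `[0, T]` (`∂ₜw` the one-sided time derivative within `[0, T]`), and a real exponent `θ ≥ 2`,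
with `E(t) = ∫ ‖w(t)‖^θ` and `Φ(t) = ∫ θ ‖w(t)‖^{θ-2} ⟪w(t), ∂ₜw(t)⟫`: `Φ` is integrable on
`(0, T)`, `E` is continuous on `[0, T]`, and `E(b) = E(0) + ∫₀ᵇ Φ` for `b ∈ (0, T]` (pointwise
`d/dt ‖w(t,x)‖^θ = θ‖w‖^{θ-2}⟪w, ∂ₜw⟫` at interior times, the fundamental theorem of calculus in
`t` for each `x`, and Fubini). The `L^θ` twin of `IsSmoothSpaceTimeOn.l2_balance`.
[cite: LemarieRieusset2016, §11.5 Prop. 11.7 proof, (11.44) and (11.51) (PDF pp. 362, 365)] -/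
theorem IsSmoothSpaceTimeOn.lTheta_balance {T : ℝ} (hT : 0 < T)
    {w : ℝ → EuclideanSpace ℝ (Fin 3) → EuclideanSpace ℝ (Fin 3)}
    (hw : FluidPDE.IsSmoothSpaceTimeOn (Icc 0 T) w) {θ : ℝ} (hθ : 2 ≤ θ)
    {B₀ : ℝ} (hB₀ : ∀ t ∈ Icc 0 T, ∀ x, ‖w t x‖ ≤ B₀) {C₀ C₁ : ℝ≥0}
    (hC₀ : ∀ t ∈ Icc 0 T, ∫⁻ x, ‖w t x‖ₑ ^ 2 ≤ C₀)
    (hC₁ : ∀ t ∈ Icc 0 T, ∫⁻ x, ‖FluidPDE.timeDerivWithin (Icc 0 T) w t x‖ₑ ^ 2 ≤ C₁) :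
    IntegrableOn (fun t => ∫ x, θ * ‖w t x‖ ^ (θ - 2) *
      ⟪w t x, FluidPDE.timeDerivWithin (Icc 0 T) w t x⟫) (Ioo 0 T) ∧
    ContinuousOn (fun t => ∫ x, ‖w t x‖ ^ θ) (Icc 0 T) ∧
    ∀ b ∈ Ioc 0 T, ∫ x, ‖w b x‖ ^ θ =
      (∫ x, ‖w 0 x‖ ^ θ) + ∫ t in (0 : ℝ)..b, ∫ x, θ * ‖w t x‖ ^ (θ - 2) *
        ⟪w t x, FluidPDE.timeDerivWithin (Icc 0 T) w t x⟫ := by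
  have hU : UniqueDiffOn ℝ (Icc 0 T) := uniqueDiffOn_Icc hT
  set W : ℝ → EuclideanSpace ℝ (Fin 3) → EuclideanSpace ℝ (Fin 3) :=
    FluidPDE.timeDerivWithin (Icc 0 T) w with hW
  have hWsm : FluidPDE.IsSmoothSpaceTimeOn (Icc 0 T) W := hw.timeDerivWithin hU
  have cw : ContinuousOn (uncurry w) (Icc 0 T ×ˢ univ) := hw.continuousOn
  have cW : ContinuousOn (uncurry W) (Icc 0 T ×ˢ univ) := hWsm.continuousOn
  have hθ0 : 0 ≤ θ := by linarith
  have hθ2 : 0 ≤ θ - 2 := by linarith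
  have hB₀0 : 0 ≤ B₀ := (norm_nonneg _).trans (hB₀ 0 ⟨le_rfl, hT.le⟩ 0)
  -- the density `g t x = θ ‖w‖^{θ-2} ⟪w, W⟫` and the energy `E t = ∫ ‖w(t)‖^θ`
  obtain ⟨g, hg⟩ : ∃ g : ℝ → EuclideanSpace ℝ (Fin 3) → ℝ,
      g = fun t x => θ * ‖w t x‖ ^ (θ - 2) * ⟪w t x, W t x⟫ := ⟨_, rfl⟩
  obtain ⟨E, hE⟩ : ∃ E : ℝ → ℝ, E = fun t => ∫ x, ‖w t x‖ ^ θ := ⟨_, rfl⟩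
  have hgt : ∀ t x, g t x = θ * ‖w t x‖ ^ (θ - 2) * ⟪w t x, W t x⟫ := fun t x => by rw [hg]
  have hEt : ∀ t, E t = ∫ x, ‖w t x‖ ^ θ := fun t => by rw [hE]
  have cg : ContinuousOn (uncurry g) (Icc 0 T ×ˢ univ) := by
    rw [hg]
    exact (continuousOn_const.mul (cw.norm.rpow_const fun z _ => Or.inr hθ2)).mul (cw.inner cW)
  have cpow : ContinuousOn (fun z : ℝ × EuclideanSpace ℝ (Fin 3) => ‖w z.1 z.2‖ ^ θ)
      (Icc 0 T ×ˢ univ) := cw.norm.rpow_const fun z _ => Or.inr hθ0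
  -- slices
  have cwt : ∀ t ∈ Icc 0 T, Continuous (w t) := fun t ht => (hw.contDiff_slice ht).continuous
  have cWt : ∀ t ∈ Icc 0 T, Continuous (W t) := fun t ht => (hWsm.contDiff_slice ht).continuous
  have hw_lt : ∀ t ∈ Icc 0 T, ∫⁻ x, ‖w t x‖ₑ ^ 2 < ⊤ := fun t ht =>
    (hC₀ t ht).trans_lt ENNReal.coe_lt_top
  have hW_lt : ∀ t ∈ Icc 0 T, ∫⁻ x, ‖W t x‖ₑ ^ 2 < ⊤ := fun t ht =>
    (hC₁ t ht).trans_lt ENNReal.coe_lt_top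
  have isq : ∀ t ∈ Icc 0 T, Integrable (fun x => ‖w t x‖ ^ 2) volume := fun t ht =>
    FluidPDE.integrable_sq_norm_of_lintegral_lt_top (cwt t ht) (hw_lt t ht)
  -- `‖w‖^θ ≤ B₀^{θ-2} ‖w‖²` and `‖w‖^{θ-2} ≤ B₀^{θ-2}`
  have hpow_le : ∀ t ∈ Icc 0 T, ∀ x, ‖w t x‖ ^ (θ - 2) ≤ B₀ ^ (θ - 2) := fun t ht x =>
    Real.rpow_le_rpow (norm_nonneg _) (hB₀ t ht x) hθ2
  have hpowθ : ∀ t x, ‖w t x‖ ^ θ = ‖w t x‖ ^ (θ - 2) * ‖w t x‖ ^ 2 := by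
    intro t x
    rw [← Real.rpow_natCast (‖w t x‖) 2, ← Real.rpow_add' (norm_nonneg _) (by norm_num; linarith)]
    norm_num
  have iθ : ∀ t ∈ Icc 0 T, Integrable (fun x => ‖w t x‖ ^ θ) volume := by
    intro t ht
    refine ((isq t ht).const_mul (B₀ ^ (θ - 2))).mono'
      ((cwt t ht).norm.rpow_const fun x => Or.inr hθ0).aestronglyMeasurable
      (Eventually.of_forall fun x => ?_)
    rw [Real.norm_of_nonneg (Real.rpow_nonneg (norm_nonneg _) _), hpowθ]
    exact mul_le_mul_of_nonneg_right (hpow_le t ht x) (sq_nonneg _)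
  -- pointwise bound `|g| ≤ θ B₀^{θ-2} (‖w‖² + ‖W‖²)/2` and integrability of `g` on `(0, T) × ℝ³`
  set M : ℝ := θ * B₀ ^ (θ - 2) * 2⁻¹ with hMdef
  have hM0 : 0 ≤ M := by positivity
  have hgle : ∀ t ∈ Icc 0 T, ∀ x, ‖g t x‖ ≤ M * (‖w t x‖ ^ 2 + ‖W t x‖ ^ 2) := by
    intro t ht x
    rw [hgt, norm_mul, norm_mul, Real.norm_of_nonneg hθ0,
      Real.norm_of_nonneg (Real.rpow_nonneg (norm_nonneg _) _)]
    have h1 : ‖⟪w t x, W t x⟫‖ ≤ 2⁻¹ * (‖w t x‖ ^ 2 + ‖W t x‖ ^ 2) := by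
      refine (norm_inner_le_norm (𝕜 := ℝ) _ _).trans ?_
      nlinarith [sq_nonneg (‖w t x‖ - ‖W t x‖)]
    calc θ * ‖w t x‖ ^ (θ - 2) * ‖⟪w t x, W t x⟫‖
        ≤ θ * B₀ ^ (θ - 2) * (2⁻¹ * (‖w t x‖ ^ 2 + ‖W t x‖ ^ 2)) :=
          mul_le_mul (mul_le_mul_of_nonneg_left (hpow_le t ht x) hθ0) h1 (norm_nonneg _)
            (by positivity)
      _ = M * (‖w t x‖ ^ 2 + ‖W t x‖ ^ 2) := by rw [hMdef]; ring
  have hg_lint : ∀ t ∈ Icc 0 T, ∫⁻ x, ‖g t x‖ₑ ≤ ENNReal.ofReal M * (C₀ + C₁) := by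
    intro t ht
    have hpt : ∀ x, ‖g t x‖ₑ ≤ ENNReal.ofReal M * (‖w t x‖ₑ ^ 2 + ‖W t x‖ₑ ^ 2) := by
      intro x
      have hR : ENNReal.ofReal M * (‖w t x‖ₑ ^ 2 + ‖W t x‖ₑ ^ 2) =
          ENNReal.ofReal (M * (‖w t x‖ ^ 2 + ‖W t x‖ ^ 2)) := by
        rw [ENNReal.ofReal_mul hM0, ENNReal.ofReal_add (sq_nonneg _) (sq_nonneg _),
          ENNReal.ofReal_pow (norm_nonneg _), ENNReal.ofReal_pow (norm_nonneg _), ofReal_norm,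
          ofReal_norm]
      rw [hR, ← ofReal_norm]
      exact ENNReal.ofReal_le_ofReal (hgle t ht x)
    calc ∫⁻ x, ‖g t x‖ₑ ≤ ∫⁻ x, ENNReal.ofReal M * (‖w t x‖ₑ ^ 2 + ‖W t x‖ₑ ^ 2) :=
          lintegral_mono hpt
      _ = ENNReal.ofReal M * ((∫⁻ x, ‖w t x‖ₑ ^ 2) + ∫⁻ x, ‖W t x‖ₑ ^ 2) := by
          rw [lintegral_const_mul' _ _ ENNReal.ofReal_ne_top, lintegral_add_left']
          exact (cwt t ht).aemeasurable.enorm.pow_const _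
      _ ≤ ENNReal.ofReal M * (C₀ + C₁) := by
          gcongr
          · exact hC₀ t ht
          · exact hC₁ t ht
  have hKfin : ENNReal.ofReal M * (C₀ + C₁) ≠ ⊤ :=
    ENNReal.mul_ne_top ENNReal.ofReal_ne_top
      (ENNReal.add_ne_top.2 ⟨ENNReal.coe_ne_top, ENNReal.coe_ne_top⟩)
  have hg_int : ∀ b ∈ Ioc 0 T, Integrable (uncurry g)
      (((volume : Measure ℝ).restrict (Ioo 0 b)).prod volume) := by
    intro b hb
    refine FluidPDE.integrable_prod_of_continuousOn_of_lintegral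
      (cg.mono (prod_mono (Icc_subset_Icc le_rfl hb.2) Subset.rfl)) ?_
    calc ∫⁻ t in Ioo 0 b, ∫⁻ x, ‖uncurry g (t, x)‖ₑ
        ≤ ∫⁻ _ in Ioo 0 b, ENNReal.ofReal M * (C₀ + C₁) :=
          setLIntegral_mono' measurableSet_Ioo fun t ht =>
            hg_lint t ⟨ht.1.le, ht.2.le.trans hb.2⟩
      _ < ⊤ := by
          rw [setLIntegral_const]
          exact ENNReal.mul_lt_top hKfin.lt_top (by simp)
  -- the time derivative of `‖w(t, x)‖^θ` at interior times
  have hpow_eq : ∀ t x, (‖w t x‖ ^ 2) ^ (θ / 2) = ‖w t x‖ ^ θ := by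
    intro t x
    rw [← Real.rpow_natCast (‖w t x‖) 2, ← Real.rpow_mul (norm_nonneg _)]
    congr 1
    push_cast
    ring
  have hderiv : ∀ t ∈ Ioo 0 T, ∀ x, HasDerivAt (fun τ => ‖w τ x‖ ^ θ) (g t x) t := by
    intro t ht x
    have h1 : HasDerivAt (fun τ => w τ x) (W t x) t :=
      (hw.hasDerivWithinAt_timeDerivWithin hU (Ioo_subset_Icc_self ht) x).hasDerivAt
        (Icc_mem_nhds ht.1 ht.2)
    have h2 := h1.norm_sq
    have h3 := h2.rpow_const (p := θ / 2) (Or.inr (by linarith))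
    have hfun : (fun τ => (‖w τ x‖ ^ 2) ^ (θ / 2)) = fun τ => ‖w τ x‖ ^ θ := funext fun τ => hpow_eq τ x
    rw [hfun] at h3
    refine h3.congr_deriv ?_
    rw [hgt]
    have h4 : (‖w t x‖ ^ 2) ^ (θ / 2 - 1) = ‖w t x‖ ^ (θ - 2) := by
      rw [← Real.rpow_natCast (‖w t x‖) 2, ← Real.rpow_mul (norm_nonneg _)]
      congr 1
      push_cast
      ring
    rw [h4]
    ring
  -- FTC in `t` for each `x`, on `[0, b]`
  have hFTC : ∀ b ∈ Ioc 0 T, ∀ x, ∫ t in (0 : ℝ)..b, g t x = ‖w b x‖ ^ θ - ‖w 0 x‖ ^ θ := by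
    intro b hb x
    have hsub : Icc 0 b ⊆ Icc 0 T := Icc_subset_Icc le_rfl hb.2
    have hc : ContinuousOn (fun τ => ((τ, x) : ℝ × EuclideanSpace ℝ (Fin 3))) (Icc 0 b) :=
      (continuous_id.prodMk continuous_const).continuousOn
    have hmaps : MapsTo (fun τ => ((τ, x) : ℝ × EuclideanSpace ℝ (Fin 3))) (Icc 0 b)
        (Icc 0 T ×ˢ univ) := fun τ hτ => mk_mem_prod (hsub hτ) (mem_univ x)
    have hcont : ContinuousOn (fun τ => ‖w τ x‖ ^ θ) (Icc 0 b) :=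
      (cpow.comp hc hmaps).congr fun τ _ => rfl
    have hcg : ContinuousOn (fun τ => g τ x) (Icc 0 b) := (cg.comp hc hmaps).congr fun τ _ => rfl
    exact intervalIntegral.integral_eq_sub_of_hasDerivAt_of_le (f := fun τ => ‖w τ x‖ ^ θ)
      (f' := fun τ => g τ x) hb.1.le hcont (fun t ht => hderiv t ⟨ht.1, ht.2.trans_le hb.2⟩ x)
      (hcg.intervalIntegrable_of_Icc hb.1.le)
  -- Fubini: `E b - E 0 = ∫₀ᵇ ∫ g`
  obtain ⟨φ, hφ⟩ : ∃ φ : ℝ → ℝ, φ = fun t => ∫ x, g t x := ⟨_, rfl⟩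
  have hφt : ∀ t, φ t = ∫ x, g t x := fun t => by rw [hφ]
  have hφ_int : IntegrableOn φ (Ioo 0 T) volume := by
    rw [hφ]; exact (hg_int T ⟨hT, le_rfl⟩).integral_prod_left
  have hEb : ∀ b ∈ Ioc 0 T, E b = E 0 + ∫ t in (0 : ℝ)..b, φ t := by
    intro b hb
    have hI := hg_int b hb
    have hswap := integral_integral_swap (μ := (volume : Measure ℝ).restrict (Ioo 0 b))
      (ν := (volume : Measure (EuclideanSpace ℝ (Fin 3)))) (f := fun t x => g t x) hI
    have hx : ∫ x, ∫ t in Ioo 0 b, g t x = E b - E 0 := by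
      have : (fun x => ∫ t in Ioo 0 b, g t x) = fun x => ‖w b x‖ ^ θ - ‖w 0 x‖ ^ θ := by
        funext x
        rw [← hFTC b hb x, intervalIntegral.integral_of_le hb.1.le, integral_Ioc_eq_integral_Ioo]
      rw [this, integral_sub (iθ b ⟨hb.1.le, hb.2⟩) (iθ 0 ⟨le_rfl, hT.le⟩), hEt, hEt]
    rw [intervalIntegral.integral_of_le hb.1.le, integral_Ioc_eq_integral_Ioo]
    simp only [hφt]
    rw [hswap, hx]
    ring
  -- continuity of `E` on `[0, T]`
  have hEcont : ContinuousOn E (Icc 0 T) := by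
    have hprim : ContinuousOn (fun b => ∫ t in (0 : ℝ)..b, φ t) (Icc 0 T) := by
      have h := intervalIntegral.continuousOn_primitive_interval (μ := volume) (f := φ) (a := 0)
        (b := T) (by
          rw [uIcc_of_le hT.le]
          exact (hφ_int.congr_set_ae Ioo_ae_eq_Icc.symm))
      rwa [uIcc_of_le hT.le] at h
    have heq : ∀ b ∈ Icc 0 T, E b = E 0 + ∫ t in (0 : ℝ)..b, φ t := by
      intro b hb
      rcases eq_or_lt_of_le hb.1 with h | h
      · rw [← h]; simp
      · exact hEb b ⟨h, hb.2⟩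
    exact (continuousOn_const.add hprim).congr heq
  refine ⟨?_, ?_, fun b hb => ?_⟩
  · refine hφ_int.congr_fun (fun t _ => ?_) measurableSet_Ioo
    rw [hφt]
    refine integral_congr_ae (Eventually.of_forall fun x => ?_)
    simp only [hgt]
  · rw [hE] at hEcont
    exact hEcont
  · have h := hEb b hb
    rw [hEt, hEt] at h
    rw [h]
    congr 1
    refine intervalIntegral.integral_congr fun t _ => ?_
    rw [hφt]
    refine integral_congr_ae (Eventually.of_forall fun x => ?_)
    simp only [hgt]

end Balance

end Literature.Analysis.FluidPDE

end
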